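import Summits.SmoothPoincare4.SmoothPoincare4.Theorems.CongruenceShadowsGriffithsHandlebodyExtensionCoverDefs
import HarnessLib

/-!
# SmoothPoincare4 / CongruenceShadows — `GriffithsHandlebodyExtension` (item stmt-SmoothPoincare4-15190): the homothety-cover core, II — the leaf profile

Support file (`--supports` stmt-SmoothPoincare4-15190) of the homothety-cover proof of the genus-one
clause (E) of Griffiths' handlebody extension theorem — *every self-diffeomorphism of the Heegaard torus
`∂V` of the round solid torus fixing the base point and acting trivially on `π₁(∂V)` extends to a
self-diffeomorphism of `V`* (hypothesis `hE` of
`Literature.Topology.FourManifolds.RoundSolidTorusModel.diffeoExtends_of_map_ker_eq_ker_of_forall_diffeoExtends`).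
See the module docstring of `…CoverDefs` for the whole line (E1–E6) and the notation
(`τ̂`, `δ_λ`, `ρ`, `χ`, `f`, `Δ^(c)`, `α`, `L`, `M`, `Ψ̂`, `ẽ_c`).

This part: elementary consequences of the `CoreData` axioms, the radial size `ρ = ‖τ̂⁻¹‖` (continuity at the
origin from equivariance), the cut-off `χ` and the leaf profile `f c Y = c − ρ(Y) χ(ρ(Y)/c)`
(monotonicity in `c`, disjointness and equivariance of the leaves `Δ^(c)`, smoothness, surjectivity in `c`).
-/

-- the registered namespace `Summit.SmoothPoincare4.SmoothPoincare4.Theorems` repeats a component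
set_option linter.dupNamespace false

noncomputable section

namespace Summit.SmoothPoincare4.SmoothPoincare4.Theorems

namespace HomothetyCover

open Set Function Metric Filter
open scoped Topology ContDiff

namespace CoreData

variable (D : CoreData)

/-- `λ > 0`. -/
theorem lam_pos : 0 < D.lam := lt_trans zero_lt_one D.one_lt_lam

/-- `λ ≠ 0`. -/
theorem lam_ne_zero : D.lam ≠ 0 := D.lam_pos.ne'

/-- `τ̂` has no zero off the origin (it has the inverse `τ̂'` and `τ̂' 0 = 0`). -/
theorem τ_ne_zero {y : E2} (hy : y ≠ 0) : D.τ y ≠ 0 := fun h => hy (by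
  have := D.τ'_τ y; rw [h, D.τ'_zero] at this; exact this.symm)

/-- `τ̂'` has no zero off the origin. -/
theorem τ'_ne_zero {y : E2} (hy : y ≠ 0) : D.τ' y ≠ 0 := fun h => hy (by
  have := D.τ_τ' y; rw [h, D.τ_zero] at this; exact this.symm)

/-- `τ̂` is injective (left inverse `τ̂'`). -/
theorem τ_injective : Injective D.τ := fun a b h => by
  have := congrArg D.τ' h; rwa [D.τ'_τ, D.τ'_τ] at this

/-- The inverse `τ̂'` is `δ_λ`-equivariant as well. -/
theorem τ'_smul (w : E2) : D.τ' (D.lam • w) = D.lam • D.τ' w := by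
  apply D.τ_injective
  rw [D.τ_τ', D.τ_smul, D.τ_τ']

/-- `τ̂` commutes with the powers `δ_λ^n`. -/
theorem τ_pow_smul (n : ℕ) (y : E2) : D.τ (D.lam ^ n • y) = D.lam ^ n • D.τ y := by
  induction n with
  | zero => simp
  | succ n ih => rw [pow_succ', mul_smul, D.τ_smul, ih, mul_smul]

/-- `τ̂'` commutes with the powers `δ_λ^n`. -/
theorem τ'_pow_smul (n : ℕ) (y : E2) : D.τ' (D.lam ^ n • y) = D.lam ^ n • D.τ' y := by
  induction n with
  | zero => simp
  | succ n ih => rw [pow_succ', mul_smul, D.τ'_smul, ih, mul_smul]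

/-! ### The radial function `ρ = ‖τ̂⁻¹‖` -/

/-- `ρ ≥ 0`. -/
theorem ρ_nonneg (Y : E2) : 0 ≤ D.ρ Y := norm_nonneg _

/-- `ρ 0 = 0`. -/
@[simp] theorem ρ_zero : D.ρ 0 = 0 := by simp [ρ, D.τ'_zero]

/-- `ρ > 0` off the origin. -/
theorem ρ_pos {Y : E2} (hY : Y ≠ 0) : 0 < D.ρ Y := norm_pos_iff.2 (D.τ'_ne_zero hY)

/-- `ρ (τ̂ y) = ‖y‖`: the level set `{ρ = c}` is the lifted meridian `τ̂ {‖y‖ = c}`. -/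
theorem ρ_τ (y : E2) : D.ρ (D.τ y) = ‖y‖ := by simp [ρ, D.τ'_τ]

/-- `ρ` is homogeneous of degree one under `δ_λ`. -/
theorem ρ_smul (Y : E2) : D.ρ (D.lam • Y) = D.lam * D.ρ Y := by
  simp [ρ, D.τ'_smul, norm_smul, abs_of_pos D.lam_pos]

/-- `ρ` is smooth off the origin. -/
theorem contDiffAt_ρ {Y : E2} (hY : Y ≠ 0) : ContDiffAt ℝ ∞ D.ρ Y :=
  (D.contDiffAt_τ' Y hY).norm ℝ (D.τ'_ne_zero hY)

/-- `τ̂⁻¹` is bounded on the fundamental annulus `{1 ≤ ‖y‖ ≤ λ}`. -/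
theorem exists_bound_ρ : ∃ B, 0 < B ∧ ∀ Y : E2, 1 ≤ ‖Y‖ → ‖Y‖ ≤ D.lam → D.ρ Y ≤ B := by
  have hA : IsCompact (closedBall (0 : E2) D.lam ∩ {y | 1 ≤ ‖y‖}) :=
    (isCompact_closedBall _ _).inter_right (isClosed_le continuous_const continuous_norm)
  have hcont : ContinuousOn D.ρ (closedBall (0 : E2) D.lam ∩ {y | 1 ≤ ‖y‖}) := by
    intro y hy
    have hy0 : y ≠ 0 := by
      intro h; have := hy.2; simp only [h, mem_setOf_eq, norm_zero] at this; norm_num at this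
    exact (D.contDiffAt_ρ hy0).continuousAt.continuousWithinAt
  obtain ⟨B, hB⟩ := hA.exists_bound_of_continuousOn hcont
  refine ⟨max B 1, lt_of_lt_of_le zero_lt_one (le_max_right _ _), fun Y h1 h2 => ?_⟩
  have h := hB Y ⟨by simpa using h2, h1⟩
  rw [Real.norm_eq_abs, abs_of_nonneg (D.ρ_nonneg Y)] at h
  exact h.trans (le_max_left _ _)

/-- `ρ → 0` at the origin (equivariance and boundedness on a fundamental annulus). -/
theorem tendsto_ρ_zero : Tendsto D.ρ (𝓝 0) (𝓝 0) := by
  obtain ⟨B, hB, hbound⟩ := D.exists_bound_ρ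
  rw [Metric.tendsto_nhds_nhds]
  intro ε hε
  obtain ⟨N, hN⟩ := pow_unbounded_of_one_lt (B / ε) D.one_lt_lam
  have hlamN : 0 < D.lam ^ N := pow_pos D.lam_pos N
  refine ⟨(D.lam ^ N)⁻¹, inv_pos.2 hlamN, fun Y hY => ?_⟩
  rw [dist_zero_right] at hY
  rw [dist_zero_right, Real.norm_eq_abs, abs_of_nonneg (D.ρ_nonneg Y)]
  by_cases hY0 : Y = 0
  · simp [hY0, hε]
  have hnY : 0 < ‖Y‖ := norm_pos_iff.2 hY0
  have hle1 : ‖Y‖ < 1 := lt_of_lt_of_le hY (inv_le_one_of_one_le₀ (one_le_pow₀ D.one_lt_lam.le))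
  have hx : 1 ≤ ‖Y‖⁻¹ := (one_le_inv₀ hnY).2 hle1.le
  obtain ⟨n, hn1, hn2⟩ := exists_nat_pow_near hx D.one_lt_lam
  -- `Z = λ^(n+1) • Y` lies in the fundamental annulus
  set Z : E2 := D.lam ^ (n + 1) • Y with hZ
  have hnZ : ‖Z‖ = D.lam ^ (n + 1) * ‖Y‖ := by
    rw [hZ, norm_smul, Real.norm_eq_abs, abs_of_pos (pow_pos D.lam_pos _)]
  have hZ1 : 1 ≤ ‖Z‖ := by
    rw [hnZ]
    have := mul_lt_mul_of_pos_right hn2 hnY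
    rw [inv_mul_cancel₀ hnY.ne'] at this
    exact this.le
  have hZ2 : ‖Z‖ ≤ D.lam := by
    rw [hnZ, pow_succ]
    have h := mul_le_mul_of_nonneg_right hn1 hnY.le
    rw [inv_mul_cancel₀ hnY.ne'] at h
    nlinarith [D.lam_pos]
  have hρZ : D.ρ Z = D.lam ^ (n + 1) * D.ρ Y := by
    rw [hZ, ρ, D.τ'_pow_smul, norm_smul, Real.norm_eq_abs, abs_of_pos (pow_pos D.lam_pos _)]
    rfl
  have hb := hbound Z hZ1 hZ2
  rw [hρZ] at hb
  -- compare exponents: `λ^N < ‖Y‖⁻¹ < λ^(n+1)`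
  have hNn : D.lam ^ N < D.lam ^ (n + 1) := by
    have : (D.lam ^ N) < ‖Y‖⁻¹ := by
      rwa [lt_inv_comm₀ hlamN hnY]
    exact this.trans hn2
  have hpos : 0 < D.lam ^ (n + 1) := pow_pos D.lam_pos _
  have h1 : D.ρ Y ≤ B / D.lam ^ (n + 1) := by
    rw [le_div_iff₀ hpos]; linarith
  have h2 : B / D.lam ^ (n + 1) < B / D.lam ^ N := div_lt_div_of_pos_left hB hlamN hNn
  have h3 : B / D.lam ^ N < ε := by
    rw [div_lt_iff₀ hlamN]
    have := hN
    rw [div_lt_iff₀ hε] at this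
    linarith
  linarith

/-- `ρ` is continuous at the origin. -/
theorem continuousAt_ρ_zero : ContinuousAt D.ρ 0 := by
  have := D.tendsto_ρ_zero
  rwa [ContinuousAt, D.ρ_zero]

/-- `ρ` is continuous on the whole plane. -/
theorem continuous_ρ : Continuous D.ρ := by
  rw [continuous_iff_continuousAt]
  intro Y
  by_cases hY : Y = 0
  · rw [hY]; exact D.continuousAt_ρ_zero
  · exact (D.contDiffAt_ρ hY).continuousAt

/-! ### The profile `χ` and the leaf height `f` -/

/-- `χ ≥ 0`. -/
theorem χ_nonneg (r : ℝ) : 0 ≤ χ r := Real.smoothTransition.nonneg _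

/-- `χ ≤ 1`. -/
theorem χ_le_one (r : ℝ) : χ r ≤ 1 := Real.smoothTransition.le_one _

/-- `χ` is monotone. -/
theorem χ_monotone : Monotone χ := fun a b h =>
  Real.smoothTransition.monotone (by linarith)

/-- `χ = 0` on `(-∞, 1/4]`. -/
theorem χ_of_le {r : ℝ} (h : r ≤ 1 / 4) : χ r = 0 :=
  Real.smoothTransition.zero_of_nonpos (by linarith)

/-- `χ = 1` on `[1/2, ∞)`. -/
theorem χ_of_ge {r : ℝ} (h : 1 / 2 ≤ r) : χ r = 1 :=
  Real.smoothTransition.one_of_one_le (by linarith)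

/-- `χ 1 = 1`. -/
@[simp] theorem χ_one : χ 1 = 1 := χ_of_ge (by norm_num)

/-- `χ` is smooth. -/
theorem contDiff_χ : ContDiff ℝ ∞ χ :=
  Real.smoothTransition.contDiff.comp ((contDiff_const.mul contDiff_id).sub contDiff_const)

/-- Over the origin the leaf `Δ^(c)` has height `c`: `f c 0 = c`. -/
@[simp] theorem f_zero_right (c : ℝ) : D.f c 0 = c := by simp [f]

/-- The key monotonicity: `f` grows at least with unit speed in `c`. -/
theorem sub_le_f_sub_f {c₁ c₂ : ℝ} (hc₁ : 0 < c₁) (h : c₁ ≤ c₂) (Y : E2) :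
    c₂ - c₁ ≤ D.f c₂ Y - D.f c₁ Y := by
  have hρ := D.ρ_nonneg Y
  have hc₂ : 0 < c₂ := lt_of_lt_of_le hc₁ h
  have hdiv : D.ρ Y / c₂ ≤ D.ρ Y / c₁ := div_le_div_of_nonneg_left hρ hc₁ h
  have hχ := χ_monotone hdiv
  simp only [f]
  nlinarith [mul_le_mul_of_nonneg_left hχ hρ]

/-- `f` is strictly increasing in the leaf parameter. -/
theorem f_lt_f {c₁ c₂ : ℝ} (hc₁ : 0 < c₁) (h : c₁ < c₂) (Y : E2) : D.f c₁ Y < D.f c₂ Y := by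
  have := D.sub_le_f_sub_f hc₁ h.le Y; linarith

/-- `f · Y` is injective on `(0, ∞)`: distinct leaves are disjoint. -/
theorem f_injective_left {c₁ c₂ : ℝ} (hc₁ : 0 < c₁) (hc₂ : 0 < c₂) {Y : E2}
    (h : D.f c₁ Y = D.f c₂ Y) : c₁ = c₂ := by
  rcases lt_trichotomy c₁ c₂ with hlt | heq | hgt
  · exact absurd h (D.f_lt_f hc₁ hlt Y).ne
  · exact heq
  · exact absurd h.symm (D.f_lt_f hc₂ hgt Y).ne

/-- `c - ρ Y ≤ f c Y` (`χ ≤ 1`). -/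
theorem sub_ρ_le_f {c : ℝ} (Y : E2) : c - D.ρ Y ≤ D.f c Y := by
  have := mul_le_of_le_one_right (D.ρ_nonneg Y) (χ_le_one (D.ρ Y / c))
  simp only [f]; linarith

/-- `f c Y ≤ c` (`χ ≥ 0`). -/
theorem f_le (c : ℝ) (Y : E2) : D.f c Y ≤ c := by
  have := mul_nonneg (D.ρ_nonneg Y) (χ_nonneg (D.ρ Y / c))
  simp only [f]; linarith

/-- `f c Y ≥ 0 ↔ ρ Y ≤ c`: the leaf `Δ^(c)` lies in the closed upper half-space exactly over `{ρ ≤ c}`. -/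
theorem f_nonneg_iff {c : ℝ} (hc : 0 < c) (Y : E2) : 0 ≤ D.f c Y ↔ D.ρ Y ≤ c := by
  constructor
  · intro h
    by_contra hlt
    rw [not_le] at hlt
    have h1 : 1 / 2 ≤ D.ρ Y / c := by
      rw [le_div_iff₀ hc]; linarith
    have : D.f c Y = c - D.ρ Y := by simp [f, χ_of_ge h1]
    linarith
  · intro h
    exact le_trans (by linarith) (D.sub_ρ_le_f Y)

/-- `f c` vanishes on the lifted meridian `{ρ = c}`: `∂Δ^(c) = τ̂ {‖y‖ = c}`. -/
theorem f_eq_zero_of_ρ_eq {c : ℝ} (hc : 0 < c) {Y : E2} (h : D.ρ Y = c) : D.f c Y = 0 := by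
  rw [f, h, div_self hc.ne', χ_one]; ring

/-- `f (λc) (λY) = λ f c Y`: the leaves are permuted by the deck homothety, `δ_λ Δ^(c) = Δ^(λc)`. -/
theorem f_smul (c : ℝ) (Y : E2) :
    D.f (D.lam * c) (D.lam • Y) = D.lam * D.f c Y := by
  simp only [f, D.ρ_smul]
  rw [mul_div_mul_left _ _ D.lam_ne_zero]
  ring

/-- `f` is smooth at `(c, Y)` for `c > 0`, `Y ≠ 0`. -/
theorem contDiffAt_f_of_ne {c : ℝ} (hc : 0 < c) {Y : E2} (hY : Y ≠ 0) :
    ContDiffAt ℝ ∞ (uncurry D.f) (c, Y) := by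
  have h1 : ContDiffAt ℝ ∞ (fun x : ℝ × E2 => D.ρ x.2) (c, Y) :=
    ContDiffAt.comp (x := (c, Y)) (g := D.ρ) (f := Prod.snd) (D.contDiffAt_ρ hY) contDiffAt_snd
  have h2 : ContDiffAt ℝ ∞ (fun x : ℝ × E2 => D.ρ x.2 / x.1) (c, Y) :=
    h1.div contDiffAt_fst hc.ne'
  have h3 : ContDiffAt ℝ ∞ (fun x : ℝ × E2 => χ (D.ρ x.2 / x.1)) (c, Y) :=
    contDiff_χ.contDiffAt.comp (c, Y) h2
  exact contDiffAt_fst.sub (h1.mul h3)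

/-- `f = fst` near `(c, 0)`: there `ρ/c ≤ 1/4`. -/
theorem f_eventuallyEq_fst {c : ℝ} (hc : 0 < c) :
    uncurry D.f =ᶠ[𝓝 (c, (0 : E2))] fun x => x.1 := by
  have hopen : IsOpen {x : ℝ × E2 | c / 2 < x.1 ∧ D.ρ x.2 < c / 8} :=
    (isOpen_lt continuous_const continuous_fst).inter
      (isOpen_lt (D.continuous_ρ.comp continuous_snd) continuous_const)
  have hmem : (c, (0 : E2)) ∈ {x : ℝ × E2 | c / 2 < x.1 ∧ D.ρ x.2 < c / 8} := by
    constructor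
    · show c / 2 < c; linarith
    · show D.ρ 0 < c / 8; rw [D.ρ_zero]; linarith
  filter_upwards [hopen.mem_nhds hmem] with x hx
  obtain ⟨hx1, hx2⟩ := hx
  have hx1' : 0 < x.1 := by linarith
  have hq : D.ρ x.2 / x.1 ≤ 1 / 4 := by
    rw [div_le_iff₀ hx1']
    linarith [D.ρ_nonneg x.2]
  simp [uncurry, f, χ_of_le hq]

/-- `f` is smooth at every `(c, Y)` with `c > 0`. -/
theorem contDiffAt_f {c : ℝ} (hc : 0 < c) (Y : E2) : ContDiffAt ℝ ∞ (uncurry D.f) (c, Y) := by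
  by_cases hY : Y = 0
  · subst hY
    exact (contDiffAt_fst (𝕜 := ℝ) (E := ℝ) (F := E2)).congr_of_eventuallyEq (D.f_eventuallyEq_fst hc)
  · exact D.contDiffAt_f_of_ne hc hY

/-- `c ↦ f c Y` is continuous on `[c₀, ∞)`, `c₀ > 0`. -/
theorem continuous_f_left {c₀ : ℝ} (hc₀ : 0 < c₀) (Y : E2) : ContinuousOn (fun c => D.f c Y) (Ici c₀) := by
  intro c hc
  have hc' : 0 < c := lt_of_lt_of_le hc₀ hc
  have h2 : ContinuousAt (fun c : ℝ => (c, Y)) c := (continuous_id.prodMk continuous_const).continuousAt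
  have h3 : ContinuousAt (uncurry D.f ∘ fun c : ℝ => (c, Y)) c :=
    ContinuousAt.comp (D.contDiffAt_f hc' Y).continuousAt h2
  exact h3.continuousWithinAt

/-- Solving `f c Y = s` for `c`, with `ρ Y ≤ c` (intermediate value theorem). -/
theorem exists_f_eq {Y : E2} (hY : Y ≠ 0) {s : ℝ} (hs : 0 ≤ s) :
    ∃ c, D.ρ Y ≤ c ∧ D.f c Y = s := by
  set c₀ := D.ρ Y with hc₀
  have hc₀pos : 0 < c₀ := D.ρ_pos hY
  have h0 : D.f c₀ Y = 0 := D.f_eq_zero_of_ρ_eq hc₀pos rfl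
  have h1 : s ≤ D.f (c₀ + s + 1) Y := by
    have := D.sub_le_f_sub_f hc₀pos (by linarith : c₀ ≤ c₀ + s + 1) Y
    linarith
  have hcont : ContinuousOn (fun c => D.f c Y) (Icc c₀ (c₀ + s + 1)) :=
    (D.continuous_f_left hc₀pos Y).mono Icc_subset_Ici_self
  obtain ⟨c, hc, hcs⟩ := intermediate_value_Icc (by linarith) hcont ⟨by linarith [h0.le], h1⟩
  exact ⟨c, hc.1, hcs⟩

end CoreData

end HomothetyCover

end Summit.SmoothPoincare4.SmoothPoincare4.Theorems

end
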